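import Mathlib
import HarnessLib

/-!
# PointLineInducedMatchings

Topic `Literature/Combinatorics/Extremal`. Named literature fact(s) relocated by the gate from `Summits/MatrixMultiplication/MatrixMultiplication/Theorems/LevelGradedCohnUmansLevelOneGL2DesignsTangencyNearThreeHalves.lean`
(accept-time relocation of `[cite]`d propositions written inline in a Summits proposal; human ruling 2026-08-15).
Sources: Pohoata2026SharpExponentMinimalDistance.

* `Literature.Combinatorics.Extremal.InducedMatchingsNearThreeHalves`
-/

namespace Literature.Combinatorics.Extremal

open Finset Matrix

/-- **Pohoata 2026, Theorem 1.3 (induced point–line matchings over prime fields near exponent `3/2`).**  For every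
prime `r ≥ 5` there are `c > 0` and `q₀` such that for every prime `q ≥ q₀` with `q ≡ ±1 (mod r)` the affine plane
over `ZMod q` contains a point set `V` of size `≥ c · q^{3/2 − 2/(r−1)}` every point `v` of which lies on a line
`{w : u ⬝ᵥ w = u ⬝ᵥ v}` (`u ≠ 0`) meeting `V` only in `v` — equivalently an induced matching of that size in the
point–line incidence graph of `𝔽_q²` (`IM(2,q) ≳_r q^{3/2 − 2/(r−1)}`).  Proof in the source: parabola lift of
the trace-zero slice of `2𝒪_K`, `K = ℚ(ζ_r + ζ_r⁻¹)`, reduced modulo a degree-one prime (Prop. 5.1); this refutes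
the prime-field power-saving prediction 10.2 of Hunter–Pohoata–Verstraëte–Zhang (arXiv:2601.19879).
[cite: Pohoata2026SharpExponentMinimalDistance, Thm. 1.3 and Prop. 5.1]
[file Combinatorics/Extremal/PointLineInducedMatchings] -/
def InducedMatchingsNearThreeHalves : Prop :=
  ∀ r : ℕ, r.Prime → 5 ≤ r → ∃ c : ℝ, 0 < c ∧ ∃ q₀ : ℕ, ∀ q : ℕ, q.Prime → q₀ ≤ q →
    (q % r = 1 ∨ q % r = r - 1) →
    ∃ V : Finset (Fin 2 → ZMod q), c * (q : ℝ) ^ ((3 : ℝ) / 2 - 2 / ((r : ℝ) - 1)) ≤ V.card ∧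
      ∀ v ∈ V, ∃ u : Fin 2 → ZMod q, u ≠ 0 ∧ ∀ w ∈ V, u ⬝ᵥ w = u ⬝ᵥ v → w = v

end Literature.Combinatorics.Extremal
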